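import Literature.NumberTheory.LFunctions.LogIntegralProofs
import Literature.NumberTheory.LFunctions.LandauOscillation
import Literature.Probability.Distributions.ExponentialLogMoment
import Mathlib.Analysis.SpecialFunctions.Gamma.Basic
import Mathlib.Analysis.SpecialFunctions.Log.Deriv
import Mathlib.MeasureTheory.Function.JacobianOneDim
import Mathlib.Analysis.Normed.Group.FunctionSeries
import HarnessLib

/-!
# The Laplace transform of the logarithmic integral: `s ∫₁^∞ li(x) x^{-s-1} dx = −log(s − 1)`

RH-FREE real analysis (support file for [AriasDeReyna2011KeiperLi] §5, eq. (21): the `li`-half of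
`log{(s−1)ζ(s)} = s∫₁^∞ {Π(x) − li(x)} x^{−s−1} dx`).  With the tree's SERIES definition of the
logarithmic integral (`Literature.NumberTheory.LFunctions.logIntegral`,
`li x = γ + log log x + Σ_{n≥1} (log x)ⁿ/(n·n!)`, i.e. `li(eᵘ) = Ei(u)`), we prove

* `measurable_logIntegral` — `li` is Borel measurable (the series part is an entire function of
  `log x`, `continuous_expIntegralSeries`);
* `abs_logIntegral_exp_le` — `|li(eᵗ)| ≤ |γ| + |log t| + (eᵗ − 1)` for `t > 0`;
* `integral_logIntegral_exp_mul_exp_neg` — **the Laplace transform of `Ei`**: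
  `∫₀^∞ li(eᵗ) e^{−st} dt = −log(s − 1)/s` for real `s > 1` (termwise:
  `γ/s − (log s + γ)/s − log(1 − 1/s)/s`, using the tree's `∫₀^∞ log t · e^{−st} dt = −(log s + γ)/s`);
* `integral_logIntegral_mul_rpow` / `mellinIoi_logIntegral` — the Mellin form
  `∫₁^∞ li(x) x^{−(s+1)} dx = −log(s − 1)/s` (`x = eᵗ`), also as the tree's `Landau.mellinIoi`;
* integrability companions (`integrableOn_logIntegral_exp_mul_exp_neg`,
  `integrableOn_logIntegral_mul_rpow`, `integrableOn_logIntegral_Ioc`).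

bears_on (cell rh-crit/dbl bookkeeping): L-C/L-P (COLUMN 4 LI) support; nothing here concerns `ζ`.

## References
* [AriasDeReyna2011KeiperLi] J. Arias de Reyna, *Asymptotics of Keiper–Li coefficients*, Funct. Approx.
  Comment. Math. 45 (2011) 7–21, eq. (21) p.17.
* [AbramowitzStegun1964] 5.1.10 (`Ei(x) = γ + ln x + Σ xⁿ/(n·n!)`); Erdélyi et al., *Tables of Integral
  Transforms* I, 4.8 (Laplace transform of `Ei`).
-/

noncomputable section

open Real Filter Topology Set MeasureTheory
open scoped Nat

namespace Literature.NumberTheory.LFunctions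

namespace LogIntegralLaplace

/-! ### The series part of `li` as an entire function -/

/-- The series `E(u) = Σ_{n≥0} u^{n+1}/((n+1)(n+1)!) = Ei(u) − γ − log u`. [cite: AbramowitzStegun1964, 5.1.10] -/
def expIntegralSeries (u : ℝ) : ℝ :=
  ∑' n : ℕ, u ^ (n + 1) / ((n + 1 : ℝ) * ((n + 1)! : ℝ))

/-- `li x = γ + log log x + E(log x)` (unfolding the tree's definition). [cite: AbramowitzStegun1964, 5.1.10] -/
theorem logIntegral_eq (x : ℝ) :
    logIntegral x = eulerMascheroniConstant + Real.log (Real.log x) + expIntegralSeries (Real.log x) := by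
  rfl

/-- `li(eᵗ) = γ + log t + E(t)`. [cite: AbramowitzStegun1964, 5.1.10] -/
theorem logIntegral_exp (t : ℝ) :
    logIntegral (Real.exp t) = eulerMascheroniConstant + Real.log t + expIntegralSeries t := by
  rw [logIntegral_eq, Real.log_exp]

/-- Summability of the terms of `E(u)`. [folklore] -/
private theorem summable_expIntegralSeries_term (u : ℝ) :
    Summable (fun n : ℕ ↦ u ^ (n + 1) / ((n + 1 : ℝ) * ((n + 1)! : ℝ))) := by
  have e : (fun n : ℕ ↦ u ^ (n + 1) / ((n + 1 : ℝ) * ((n + 1)! : ℝ))) =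
      logIntegralSeriesTerm (Real.exp u) := by
    funext n; simp only [logIntegralSeriesTerm, Real.log_exp]
  rw [e]; exact summable_logIntegralSeriesTerm _

/-- The shifted exponential series: `Σ_{n≥0} u^{n+1}/(n+1)! = eᵘ − 1`. [folklore] -/
private theorem hasSum_pow_succ_div_factorial_succ (u : ℝ) :
    HasSum (fun n : ℕ ↦ u ^ (n + 1) / ((n + 1)! : ℝ)) (Real.exp u - 1) := by
  have h : HasSum (fun n : ℕ => u ^ n / (n ! : ℝ)) (Real.exp u) := by
    rw [Real.exp_eq_exp_ℝ]
    exact NormedSpace.expSeries_div_hasSum_exp u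
  have h1 := (hasSum_nat_add_iff' 1).mpr h
  simpa only [Finset.sum_range_one, pow_zero, Nat.factorial_zero, Nat.cast_one, div_one] using h1

/-- `0 ≤ E(u)` for `u ≥ 0`. [cite: AbramowitzStegun1964, 5.1.10] -/
theorem expIntegralSeries_nonneg {u : ℝ} (hu : 0 ≤ u) : 0 ≤ expIntegralSeries u :=
  tsum_nonneg fun n ↦ by positivity

/-- `E(u) ≤ eᵘ − 1` for `u ≥ 0` (drop the factor `1/(n+1) ≤ 1`). [cite: AbramowitzStegun1964, 5.1.10] -/
theorem expIntegralSeries_le {u : ℝ} (hu : 0 ≤ u) : expIntegralSeries u ≤ Real.exp u - 1 := by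
  rw [expIntegralSeries, ← (hasSum_pow_succ_div_factorial_succ u).tsum_eq]
  refine (summable_expIntegralSeries_term u).tsum_le_tsum (fun n ↦ ?_)
    (hasSum_pow_succ_div_factorial_succ u).summable
  have hf : (0 : ℝ) < ((n + 1)! : ℝ) := by positivity
  have hn : (1 : ℝ) ≤ (n + 1 : ℝ) := by
    have : (0 : ℝ) ≤ n := n.cast_nonneg
    linarith
  refine div_le_div_of_nonneg_left (by positivity) hf ?_
  calc ((n + 1)! : ℝ) = 1 * ((n + 1)! : ℝ) := (one_mul _).symm
    _ ≤ (n + 1 : ℝ) * ((n + 1)! : ℝ) := mul_le_mul_of_nonneg_right hn hf.le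

/-- `E` is continuous (locally uniformly convergent power series). [cite: AbramowitzStegun1964, 5.1.10] -/
theorem continuous_expIntegralSeries : Continuous expIntegralSeries := by
  refine continuous_iff_continuousAt.mpr fun u ↦ ?_
  set R : ℝ := |u| + 1 with hR
  have hR0 : 0 ≤ R := by positivity
  have hcont : ContinuousOn expIntegralSeries (Icc (-R) R) := by
    refine continuousOn_tsum (u := fun n : ℕ ↦ R ^ (n + 1) / ((n + 1)! : ℝ))
      (fun n ↦ ((continuous_pow (n + 1)).div_const _).continuousOn)
      (hasSum_pow_succ_div_factorial_succ R).summable (fun n x hx ↦ ?_)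
    have hf : (0 : ℝ) < ((n + 1)! : ℝ) := by positivity
    have hn : (1 : ℝ) ≤ (n + 1 : ℝ) := by
      have : (0 : ℝ) ≤ n := n.cast_nonneg
      linarith
    have hx' : |x| ≤ R := abs_le.mpr hx
    have hpos : (0 : ℝ) < (n + 1 : ℝ) * ((n + 1)! : ℝ) := by positivity
    rw [Real.norm_eq_abs, abs_div, abs_pow, abs_of_pos hpos]
    calc |x| ^ (n + 1) / ((n + 1 : ℝ) * ((n + 1)! : ℝ))
        ≤ R ^ (n + 1) / ((n + 1 : ℝ) * ((n + 1)! : ℝ)) := by gcongr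
      _ ≤ R ^ (n + 1) / (1 * ((n + 1)! : ℝ)) := by
          refine div_le_div_of_nonneg_left (by positivity) (by positivity) ?_
          exact mul_le_mul_of_nonneg_right hn hf.le
      _ = R ^ (n + 1) / ((n + 1)! : ℝ) := by rw [one_mul]
  refine hcont.continuousAt (Icc_mem_nhds ?_ ?_)
  · have := neg_abs_le u; linarith
  · have := le_abs_self u; linarith

/-- **`li` is Borel measurable.** [cite: AbramowitzStegun1964, 5.1.10 with 5.1.3] -/
theorem _root_.Literature.NumberTheory.LFunctions.measurable_logIntegral : Measurable logIntegral := by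
  have h : logIntegral = fun x ↦
      eulerMascheroniConstant + Real.log (Real.log x) + expIntegralSeries (Real.log x) := by
    funext x; rfl
  rw [h]
  exact (measurable_const.add (Real.measurable_log.comp Real.measurable_log)).add
    (continuous_expIntegralSeries.measurable.comp Real.measurable_log)

/-- `|li(eᵗ)| ≤ |γ| + |log t| + (eᵗ − 1)` for `t ≥ 0`. [cite: AbramowitzStegun1964, 5.1.10] -/
theorem abs_logIntegral_exp_le {t : ℝ} (ht : 0 ≤ t) :
    |logIntegral (Real.exp t)| ≤ |eulerMascheroniConstant| + |Real.log t| + (Real.exp t - 1) := by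
  rw [logIntegral_exp]
  refine (abs_add_le _ _).trans (add_le_add (abs_add_le _ _) ?_)
  rw [abs_of_nonneg (expIntegralSeries_nonneg ht)]
  exact expIntegralSeries_le ht

/-- `|li x| ≤ |γ| + |log log x| + x` for `x ≥ 1`. [cite: AbramowitzStegun1964, 5.1.10 with 5.1.3] -/
theorem abs_logIntegral_le {x : ℝ} (hx : 1 ≤ x) :
    |logIntegral x| ≤ |eulerMascheroniConstant| + |Real.log (Real.log x)| + x := by
  have hx0 : 0 < x := by linarith
  have h := abs_logIntegral_exp_le (Real.log_nonneg hx)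
  rw [Real.exp_log hx0] at h
  linarith

/-! ### The three Laplace transforms -/

/-- `∫₀^∞ e^{−st} dt = 1/s` (`s > 0`). [folklore] -/
private theorem integral_exp_neg_mul_Ioi {s : ℝ} (hs : 0 < s) :
    ∫ t in Ioi (0 : ℝ), Real.exp (-(s * t)) = 1 / s := by
  have h := integral_exp_mul_Ioi (a := -s) (by linarith) 0
  simp only [mul_zero, Real.exp_zero] at h
  have e : (fun t : ℝ ↦ Real.exp (-(s * t))) = fun t ↦ Real.exp (-s * t) := by
    funext t; ring_nf
  rw [e, h]
  field_simp

/-- Integrability of `e^{−st}` on `(0, ∞)` (`s > 0`). [folklore] -/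
private theorem integrableOn_exp_neg_mul_Ioi {s : ℝ} (hs : 0 < s) :
    IntegrableOn (fun t : ℝ ↦ Real.exp (-(s * t))) (Ioi 0) := by
  have h := exp_neg_integrableOn_Ioi 0 hs
  refine h.congr_fun (fun t _ ↦ by ring_nf) measurableSet_Ioi

/-- Integrability of `log t · e^{−st}` on `(0, ∞)` for `s > 1` (its integral `−(log s + γ)/s` is
nonzero). [folklore] -/
private theorem integrableOn_log_mul_exp_neg_mul_Ioi {s : ℝ} (hs : 1 < s) :
    IntegrableOn (fun t : ℝ ↦ Real.log t * Real.exp (-(s * t))) (Ioi 0) := by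
  refine Integrable.of_integral_ne_zero ?_
  rw [Literature.Probability.Distributions.integral_log_mul_exp_neg_mul_Ioi (by linarith)]
  have h1 : 0 < Real.log s := Real.log_pos hs
  have h2 : 0 < eulerMascheroniConstant :=
    lt_trans (by norm_num) Real.one_half_lt_eulerMascheroniConstant
  have : 0 < (Real.log s + eulerMascheroniConstant) / s := by positivity
  intro h
  rw [neg_div, neg_eq_zero] at h
  exact this.ne' h

/-- `∫₀^∞ t^{n+1} e^{−st} dt = (n+1)!/s^{n+2}` (`s > 0`). [folklore] -/
private theorem integral_pow_succ_mul_exp_neg_mul_Ioi {s : ℝ} (hs : 0 < s) (n : ℕ) :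
    ∫ t in Ioi (0 : ℝ), t ^ (n + 1) * Real.exp (-(s * t)) = ((n + 1)! : ℝ) / s ^ (n + 2) := by
  have h := integral_rpow_mul_exp_neg_mul_Ioi (a := (n + 2 : ℕ)) (r := s) (by positivity) hs
  have e : (∫ t in Ioi (0 : ℝ), t ^ (((n + 2 : ℕ) : ℝ) - 1) * Real.exp (-(s * t)))
      = ∫ t in Ioi (0 : ℝ), t ^ (n + 1) * Real.exp (-(s * t)) := by
    refine setIntegral_congr_fun measurableSet_Ioi fun t (ht : 0 < t) ↦ ?_
    have : (((n + 2 : ℕ) : ℝ) - 1) = ((n + 1 : ℕ) : ℝ) := by push_cast; ring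
    rw [this, Real.rpow_natCast]
  rw [← e, h]
  have hG : Real.Gamma ((n + 2 : ℕ) : ℝ) = ((n + 1)! : ℝ) := by
    rw [show ((n + 2 : ℕ) : ℝ) = ((n + 1 : ℕ) : ℝ) + 1 by push_cast; ring,
      Real.Gamma_nat_eq_factorial]
  rw [hG, Real.rpow_natCast, one_div_pow]
  field_simp

/-- Integrability of `t^{n+1} e^{−st}` on `(0,∞)` (`s > 0`). [folklore] -/
private theorem integrableOn_pow_succ_mul_exp_neg_mul_Ioi {s : ℝ} (hs : 0 < s) (n : ℕ) :
    IntegrableOn (fun t : ℝ ↦ t ^ (n + 1) * Real.exp (-(s * t))) (Ioi 0) := by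
  refine Integrable.of_integral_ne_zero ?_
  rw [integral_pow_succ_mul_exp_neg_mul_Ioi hs n]
  positivity

/-- **The series part**: `∫₀^∞ E(t) e^{−st} dt = −log(1 − 1/s)/s` for `s > 1`, termwise
(`Σ_{n≥0} 1/((n+1) s^{n+2}) = (1/s) Σ_{m≥1} s^{−m}/m`). [folklore] -/
private theorem integral_expIntegralSeries_mul_exp_neg_mul {s : ℝ} (hs : 1 < s) :
    ∫ t in Ioi (0 : ℝ), expIntegralSeries t * Real.exp (-(s * t)) = -Real.log (1 - 1 / s) / s := by
  have hs0 : 0 < s := by linarith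
  set F : ℕ → ℝ → ℝ := fun n t ↦ t ^ (n + 1) / ((n + 1 : ℝ) * ((n + 1)! : ℝ)) * Real.exp (-(s * t))
    with hF
  -- pointwise: the integrand is `Σ' F n t`
  have hpt : ∀ t, expIntegralSeries t * Real.exp (-(s * t)) = ∑' n, F n t := by
    intro t
    rw [expIntegralSeries, ← tsum_mul_right]
  -- each term integrable, with integral `1/((n+1) s^{n+2})`
  have hFint : ∀ n, Integrable (F n) (volume.restrict (Ioi 0)) := by
    intro n
    have := (integrableOn_pow_succ_mul_exp_neg_mul_Ioi hs0 n).const_mul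
      (1 / ((n + 1 : ℝ) * ((n + 1)! : ℝ)))
    refine this.congr (Eventually.of_forall fun t ↦ ?_)
    simp only [hF]; ring
  have hFval : ∀ n, ∫ t in Ioi (0 : ℝ), F n t = 1 / s * ((1 / s) ^ (n + 1) / (n + 1)) := by
    intro n
    have e : (fun t ↦ F n t) = fun t ↦
        1 / ((n + 1 : ℝ) * ((n + 1)! : ℝ)) * (t ^ (n + 1) * Real.exp (-(s * t))) := by
      funext t; simp only [hF]; ring
    rw [e, integral_const_mul, integral_pow_succ_mul_exp_neg_mul_Ioi hs0 n, one_div_pow]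
    have h1 : ((n + 1)! : ℝ) ≠ 0 := by positivity
    have h2 : (n + 1 : ℝ) ≠ 0 := by positivity
    have h3 : s ^ (n + 1) ≠ 0 := by positivity
    have h4 : s ^ (n + 2) ≠ 0 := by positivity
    rw [div_div, pow_succ]
    field_simp
  -- norms: `F n ≥ 0` on `(0,∞)`, so `∫ ‖F n‖ = ∫ F n`, a summable sequence
  have hFnorm : ∀ n, ∫ t in Ioi (0 : ℝ), ‖F n t‖ = 1 / s * ((1 / s) ^ (n + 1) / (n + 1)) := by
    intro n
    rw [← hFval n]
    refine setIntegral_congr_fun measurableSet_Ioi fun t (ht : 0 < t) ↦ ?_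
    rw [Real.norm_of_nonneg]
    simp only [hF]; positivity
  have hlog : HasSum (fun n : ℕ ↦ (1 / s) ^ (n + 1) / (n + 1)) (-Real.log (1 - 1 / s)) := by
    refine Real.hasSum_pow_div_log_of_abs_lt_one ?_
    rw [abs_of_pos (by positivity)]
    exact (div_lt_one hs0).mpr hs
  have hsum : Summable fun n ↦ ∫ t in Ioi (0 : ℝ), ‖F n t‖ := by
    simp_rw [hFnorm]
    exact (hlog.summable.mul_left (1 / s))
  calc (∫ t in Ioi (0 : ℝ), expIntegralSeries t * Real.exp (-(s * t)))
      = ∫ t in Ioi (0 : ℝ), ∑' n, F n t := setIntegral_congr_fun measurableSet_Ioi fun t _ ↦ hpt t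
    _ = ∑' n, ∫ t in Ioi (0 : ℝ), F n t := (integral_tsum_of_summable_integral_norm hFint hsum).symm
    _ = ∑' n : ℕ, 1 / s * ((1 / s) ^ (n + 1) / ((n : ℝ) + 1)) := tsum_congr hFval
    _ = 1 / s * (-Real.log (1 - 1 / s)) := by rw [← hlog.tsum_eq, ← tsum_mul_left]
    _ = -Real.log (1 - 1 / s) / s := by ring

/-- Integrability of `E(t) e^{−st}` on `(0,∞)` for `s > 1` (`0 ≤ E(t) ≤ eᵗ − 1`). [folklore] -/
private theorem integrableOn_expIntegralSeries_mul_exp_neg_mul {s : ℝ} (hs : 1 < s) :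
    IntegrableOn (fun t : ℝ ↦ expIntegralSeries t * Real.exp (-(s * t))) (Ioi 0) := by
  have hb : IntegrableOn (fun t : ℝ ↦ Real.exp (-((s - 1) * t))) (Ioi 0) :=
    integrableOn_exp_neg_mul_Ioi (by linarith)
  refine Integrable.mono' hb ?_ ?_
  · exact ((continuous_expIntegralSeries.mul (by fun_prop)).aestronglyMeasurable).restrict
  · rw [ae_restrict_iff' measurableSet_Ioi]
    refine Eventually.of_forall fun t (ht : 0 < t) ↦ ?_
    rw [Real.norm_eq_abs, abs_mul, abs_of_nonneg (expIntegralSeries_nonneg ht.le),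
      Real.abs_exp]
    calc expIntegralSeries t * Real.exp (-(s * t)) ≤ (Real.exp t - 1) * Real.exp (-(s * t)) :=
          mul_le_mul_of_nonneg_right (expIntegralSeries_le ht.le) (Real.exp_pos _).le
      _ ≤ Real.exp t * Real.exp (-(s * t)) := by gcongr; linarith
      _ = Real.exp (-((s - 1) * t)) := by rw [← Real.exp_add]; ring_nf

/-- Integrability of `li(eᵗ) e^{−st}` on `(0,∞)` for `s > 1`. [cite: AriasDeReyna2011KeiperLi, eq. (21) p.17] -/
theorem integrableOn_logIntegral_exp_mul_exp_neg {s : ℝ} (hs : 1 < s) :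
    IntegrableOn (fun t : ℝ ↦ logIntegral (Real.exp t) * Real.exp (-(s * t))) (Ioi 0) := by
  have hs0 : 0 < s := by linarith
  have h1 := ((integrableOn_exp_neg_mul_Ioi hs0).const_mul eulerMascheroniConstant)
  have h2 := integrableOn_log_mul_exp_neg_mul_Ioi hs
  have h3 := integrableOn_expIntegralSeries_mul_exp_neg_mul hs
  refine IntegrableOn.congr_fun ((h1.add h2).add h3) (fun t _ ↦ ?_) measurableSet_Ioi
  simp only [Pi.add_apply]
  rw [logIntegral_exp]; ring

/-- **The Laplace transform of the exponential integral**: for real `s > 1`,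
`∫₀^∞ li(eᵗ) e^{−st} dt = −log(s − 1)/s` (`li(eᵗ) = Ei(t)`). [cite: AriasDeReyna2011KeiperLi, eq. (21) p.17] -/
theorem integral_logIntegral_exp_mul_exp_neg {s : ℝ} (hs : 1 < s) :
    ∫ t in Ioi (0 : ℝ), logIntegral (Real.exp t) * Real.exp (-(s * t)) = -Real.log (s - 1) / s := by
  have hs0 : 0 < s := by linarith
  have h1 := ((integrableOn_exp_neg_mul_Ioi hs0).const_mul eulerMascheroniConstant)
  have h2 := integrableOn_log_mul_exp_neg_mul_Ioi hs
  have h3 := integrableOn_expIntegralSeries_mul_exp_neg_mul hs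
  have e : (fun t : ℝ ↦ logIntegral (Real.exp t) * Real.exp (-(s * t))) = fun t ↦
      (eulerMascheroniConstant * Real.exp (-(s * t)) + Real.log t * Real.exp (-(s * t)))
        + expIntegralSeries t * Real.exp (-(s * t)) := by
    funext t; rw [logIntegral_exp]; ring
  have h12 : Integrable (fun t ↦ eulerMascheroniConstant * Real.exp (-(s * t)) +
      Real.log t * Real.exp (-(s * t))) (volume.restrict (Ioi 0)) := h1.add h2
  rw [e, integral_add h12 h3, integral_add h1 h2, integral_const_mul,
    integral_exp_neg_mul_Ioi hs0,
    Literature.Probability.Distributions.integral_log_mul_exp_neg_mul_Ioi hs0,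
    integral_expIntegralSeries_mul_exp_neg_mul hs]
  have h1s : (1 : ℝ) - 1 / s ≠ 0 := by
    have : 1 / s < 1 := (div_lt_one hs0).mpr hs
    linarith
  have hlog : Real.log s + Real.log (1 - 1 / s) = Real.log (s - 1) := by
    rw [← Real.log_mul hs0.ne' h1s]
    congr 1
    field_simp
  rw [← hlog]
  ring

/-! ### Mellin form: `x = eᵗ` -/

/-- Change of variables `x = eᵗ` on `(0,∞) → (1,∞)`: `∫_{(1,∞)} g = ∫_{(0,∞)} eᵗ g(eᵗ) dt` (no
integrability hypotheses: both sides are junk together). [cite: AriasDeReyna2011KeiperLi, proof of Cor. 5.1 p.17 (change of variables `x = eᵗ`)] -/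
theorem setIntegral_Ioi_one_eq_integral_exp (g : ℝ → ℝ) :
    ∫ x in Ioi (1 : ℝ), g x = ∫ t in Ioi (0 : ℝ), Real.exp t * g (Real.exp t) := by
  have himg : Real.exp '' Ioi 0 = Ioi 1 := by rw [Real.image_exp_Ioi, Real.exp_zero]
  rw [← himg, integral_image_eq_integral_abs_deriv_smul measurableSet_Ioi
    (fun t _ ↦ (Real.hasDerivAt_exp t).hasDerivWithinAt) Real.exp_injective.injOn g]
  refine setIntegral_congr_fun measurableSet_Ioi fun t _ ↦ ?_
  rw [abs_of_pos (Real.exp_pos t), smul_eq_mul]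

/-- Change of variables for integrability: `g ∈ L¹(1,∞) ↔ eᵗ g(eᵗ) ∈ L¹(0,∞)`. [cite: AriasDeReyna2011KeiperLi, proof of Cor. 5.1 p.17 (change of variables `x = eᵗ`)] -/
theorem integrableOn_Ioi_one_iff_integrableOn_exp (g : ℝ → ℝ) :
    IntegrableOn g (Ioi 1) ↔ IntegrableOn (fun t ↦ Real.exp t * g (Real.exp t)) (Ioi 0) := by
  have himg : Real.exp '' Ioi 0 = Ioi 1 := by rw [Real.image_exp_Ioi, Real.exp_zero]
  rw [← himg, integrableOn_image_iff_integrableOn_abs_deriv_smul measurableSet_Ioi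
    (fun t _ ↦ (Real.hasDerivAt_exp t).hasDerivWithinAt) Real.exp_injective.injOn g]
  refine integrableOn_congr_fun (fun t _ ↦ ?_) measurableSet_Ioi
  rw [abs_of_pos (Real.exp_pos t), smul_eq_mul]

/-- `eᵗ · (li(eᵗ) (eᵗ)^{−(s+1)}) = li(eᵗ) e^{−st}`. [folklore] -/
private theorem exp_mul_logIntegral_mul_rpow (s t : ℝ) :
    Real.exp t * (logIntegral (Real.exp t) * Real.exp t ^ (-(s + 1))) =
      logIntegral (Real.exp t) * Real.exp (-(s * t)) := by
  rw [← Real.exp_mul]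
  have : Real.exp t * Real.exp (t * -(s + 1)) = Real.exp (-(s * t)) := by
    rw [← Real.exp_add]; ring_nf
  calc Real.exp t * (logIntegral (Real.exp t) * Real.exp (t * -(s + 1)))
      = logIntegral (Real.exp t) * (Real.exp t * Real.exp (t * -(s + 1))) := by ring
    _ = logIntegral (Real.exp t) * Real.exp (-(s * t)) := by rw [this]

/-- Integrability of `li(x) x^{−(s+1)}` on `(1,∞)` for `s > 1`. [cite: AriasDeReyna2011KeiperLi, eq. (21) p.17] -/
theorem integrableOn_logIntegral_mul_rpow {s : ℝ} (hs : 1 < s) :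
    IntegrableOn (fun x : ℝ ↦ logIntegral x * x ^ (-(s + 1))) (Ioi 1) := by
  rw [integrableOn_Ioi_one_iff_integrableOn_exp]
  simp_rw [exp_mul_logIntegral_mul_rpow]
  exact integrableOn_logIntegral_exp_mul_exp_neg hs

/-- **Mellin form**: `∫₁^∞ li(x) x^{−(s+1)} dx = −log(s − 1)/s` for real `s > 1`.
[cite: AriasDeReyna2011KeiperLi, eq. (21) p.17] -/
theorem integral_logIntegral_mul_rpow {s : ℝ} (hs : 1 < s) :
    ∫ x in Ioi (1 : ℝ), logIntegral x * x ^ (-(s + 1)) = -Real.log (s - 1) / s := by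
  rw [setIntegral_Ioi_one_eq_integral_exp]
  simp_rw [exp_mul_logIntegral_mul_rpow]
  exact integral_logIntegral_exp_mul_exp_neg hs

/-- The same in the tree's `Landau.mellinIoi` currency: `∫₁^∞ li(x) x^{−(s+1)} dx = −log(s−1)/s`
at a real point `s > 1`. [cite: AriasDeReyna2011KeiperLi, eq. (21) p.17] -/
theorem mellinIoi_logIntegral {s : ℝ} (hs : 1 < s) :
    Landau.mellinIoi logIntegral (s : ℂ) = ((-Real.log (s - 1) / s : ℝ) : ℂ) := by
  rw [← Landau.mellinIoiLog_zero, Landau.mellinIoiLog_ofReal]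
  simp only [pow_zero, one_mul, mul_one]
  rw [integral_logIntegral_mul_rpow hs]

/-! ### Local integrability of `li` at `1` -/

/-- `li(eᵗ)` is integrable on `(0, T]` (the singularity `log t` at `0` is integrable). [cite: AbramowitzStegun1964, 5.1.10 (logarithmic singularity of `Ei` at `0`)] -/
theorem integrableOn_logIntegral_exp_Ioc (T : ℝ) :
    IntegrableOn (fun t ↦ logIntegral (Real.exp t)) (Ioc 0 T) := by
  have hlog : IntegrableOn (fun t ↦ Real.log t) (Ioc 0 T) := by
    have h := (intervalIntegral.intervalIntegrable_log' (a := 0) (b := T))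
    rcases le_or_gt 0 T with hT | hT
    · exact (intervalIntegrable_iff_integrableOn_Ioc_of_le hT).mp h
    · rw [Ioc_eq_empty (by simp [hT.le])]; exact integrableOn_empty
  have hE : IntegrableOn (fun t ↦ expIntegralSeries t) (Ioc 0 T) :=
    continuous_expIntegralSeries.continuousOn.integrableOn_Icc.mono_set Ioc_subset_Icc_self
  have hc : IntegrableOn (fun _ : ℝ ↦ eulerMascheroniConstant) (Ioc 0 T) :=
    integrableOn_const (measure_Ioc_lt_top).ne
  refine IntegrableOn.congr_fun ((hc.add hlog).add hE) (fun t _ ↦ ?_) measurableSet_Ioc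
  simp only [Pi.add_apply, logIntegral_exp]

/-- **`li` is integrable on `(1, X]`** (logarithmic singularity at `1`). [cite: AbramowitzStegun1964, 5.1.10 with 5.1.3 (logarithmic singularity of `li` at `1`)] -/
theorem integrableOn_logIntegral_Ioc (X : ℝ) : IntegrableOn logIntegral (Ioc 1 X) := by
  rcases le_or_gt X 1 with hX | hX
  · rw [Ioc_eq_empty (by simp [hX])]; exact integrableOn_empty
  have hX0 : 0 < X := by linarith
  -- `(1, X] = exp '' (0, log X]`
  have himg : Real.exp '' Ioc 0 (Real.log X) = Ioc 1 X := by
    ext x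
    constructor
    · rintro ⟨t, ⟨ht0, htX⟩, rfl⟩
      refine ⟨Real.one_lt_exp_iff.mpr ht0, ?_⟩
      calc Real.exp t ≤ Real.exp (Real.log X) := Real.exp_le_exp.mpr htX
        _ = X := Real.exp_log hX0
    · rintro ⟨hx1, hxX⟩
      have hx0 : 0 < x := by linarith
      refine ⟨Real.log x, ⟨Real.log_pos hx1, Real.log_le_log hx0 hxX⟩, Real.exp_log hx0⟩
  rw [← himg, integrableOn_image_iff_integrableOn_abs_deriv_smul measurableSet_Ioc
    (fun t _ ↦ (Real.hasDerivAt_exp t).hasDerivWithinAt) Real.exp_injective.injOn]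
  -- `|exp t| • li(exp t)` on `(0, log X]`: continuous factor times integrable on the compact closure
  have h : IntegrableOn (fun t ↦ logIntegral (Real.exp t)) (Icc 0 (Real.log X)) := by
    rw [integrableOn_Icc_iff_integrableOn_Ioc]
    exact integrableOn_logIntegral_exp_Ioc (Real.log X)
  have h2 : IntegrableOn (fun t ↦ |Real.exp t| * logIntegral (Real.exp t)) (Icc 0 (Real.log X)) :=
    h.continuousOn_mul (Real.continuous_exp.abs).continuousOn isCompact_Icc
  exact (h2.mono_set Ioc_subset_Icc_self).congr_fun (fun t _ ↦ (smul_eq_mul _ _).symm)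
    measurableSet_Ioc

end LogIntegralLaplace

end Literature.NumberTheory.LFunctions
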